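import Summits.Langlands.Langlands.Theorems.IrreducibilityBySelfDualityIrreducibleOffSectorRegularAttached
import HarnessLib

/-!
# `IrreducibleOffSector` in rank four over totally real fields, regular `π`: the
# NOT essentially self-dual case (the 2026 theorem for `GL(4)`)
(crux stmt-Langlands-14329 `IrreducibilityBySelfDuality.IrreducibleOffSector`, line `Sketch`;
`--supports` file, STRUCTURAL: no import of the route module; continuation lead c6)

The printed frontier of "cuspidal ⇒ irreducible at every `ι`" moved to `n = 4` in 2026:

> A. Shavali, *Irreducibility and Monodromy of Automorphic Galois Representations of GL(4)*
> (arXiv:2603.19768), Theorem A = Corollary 4.6: "Let `K` be a totally real field and `π` be a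
> regular algebraic cuspidal automorphic representation of `GL_4(𝔸_K)` that is not essentially
> self-dual. Then for each embedding `λ : ℚ(π) ↪ ℚ̄_p`, the Galois representation
> `ρ_{π,λ} : Γ_K → GL_4(ℚ̄_p)` attached to `π` is irreducible."

(The `(3,1)`-case by Böckle–Hui's theorem on weak abelian direct summands and `∧² ρ`; the
`(2,2)`-case by the cuspidality criterion of Asgari–Raghuram for `∧² π` on `GL_6` and potential
automorphy of the `2`-dimensional constituents; self-twisted `π` by base change to the quadratic
field and the Hilbert modular case.)  This file consumes the theorem as a TEXT HYPOTHESIS (binder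
`h4`; the same text is proposed separately as the Literature named fact
`isIrreducible_galoisRep_gl4_totallyReal_of_not_essSelfDual`, file `GL4NonSelfDualIrreducible`) in the
exact shape of the tree's Böckle–Hui fact `isIrreducible_galoisRep_gl3_totallyReal` (every semisimple `r`
compatible with `(π, ι)` in the C-normalisation `arithFrobPolyOfSatake ι q_v 4 α` of lang.S27 — these
are exactly the representations equivalent to `ρ_{π,λ}`, `λ = ι⁻¹|_{ℚ(π)}`, by Chebotarev and
Brauer–Nesbitt, `FramedGaloisRep.nonempty_equiv_of_hasFrobCharpolyAt_eventually`), with "not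
essentially self-dual" rendered at Satake level as in the route's `SelfdualGL3AdjointLift` /
`isIrreducible_rank_three_of_isRegular_of_not_essSelfDual`: no cuspidal `GL(1)` datum `η` has
`t_{π,v}⁻¹ = η(ϖ_v) · t_{π,v}` for almost all `v` (if `π^∨ ≅ π ⊗ χ` then the `GL(1)` datum of `χ`
does, by `t_{π^∨} = t_π⁻¹`, `t_{π ⊗ χ} = χ(ϖ) t_π`; so the Satake-level hypothesis implies the printed
one and the text is implied by the printed corollary), and derives the corresponding CLOSED
REGION of the crux:

* `not_essSelfDual_of_twist` — Satake-level essential self-duality is invariant under the twist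
  `π ↦ π ⊗ |det|^s` (`s` real; the `GL(1)` datum is twisted by `|·|^{2s}`);
* `isIrreducible_rank_four_totallyReal_of_isRegular_of_not_essSelfDual` — `K` totally real, `π`
  cuspidal on `GL_4(𝔸_K)`, L-algebraic with a regular infinity type and not essentially self-dual at
  Satake level ⇒ every `ρ : Γ_K → GL_4(ℚ̄_ℓ)` Satake–Frobenius compatible with `(π, ι)` at almost all
  places is irreducible, for every `ℓ`, `ι` — modulo the lang.S27 text (the route input
  `GaloisRepOfRegularAlgebraic`) and the text `h4`; via the half-twist bridge of
  `…IrreducibleOffSectorRegularAttached` (`π' = π ⊗ |det|^{3/2}` is regular algebraic and still not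
  essentially self-dual; an attached `r` of `π'` is irreducible by the fact; Chebotarev–Brauer–Nesbitt
  transfer `isIrreducible_of_twist_attached_irreducible`);
* `irreducibleOffSector_rank_four_totallyReal_of_not_essSelfDual` — binder shape of the crux.

For the certified map of the open content (`…OpenRegionsV3`, p124652): the region `H4att` (`n ≥ 4`,
`K` totally real or CM, `π` regular) loses its `n = 4`, totally real, non-essentially-self-dual part;
what is left of `n = 4` over totally real fields is the ESSENTIALLY SELF-DUAL case (polarizable:
`GSp_4` / `GO_4` type — Ramakrishnan 2013, Calegari–Gee 2013, Weiss, Dieulefait–Zenteno treat almost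
all `λ`; the symmetric-cube part is the target of the symmetric-power ascent operator of this lead).

References: A. Shavali, arXiv:2603.19768 (2026), Thm. A, Cor. 4.6, Prop. 4.1, §4.2; G. Böckle,
C.-Y. Hui, Math. Ann. 393 (2025), Thm. 1.1/1.2; M. Harris, K.-W. Lan, R. Taylor, J. Thorne,
Res. Math. Sci. 3 (2016), Thm. A; K. Buzzard, T. Gee, LMS LNS 414 (2014), §5.3; H. Jacquet,
J. Shalika, Amer. J. Math. 103 (1981) II, Thm. 4.4.
-/

noncomputable section

set_option linter.dupNamespace false

open scoped NumberField Classical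
open Filter IsDedekindDomain NumberField
open Literature.NumberTheory.Automorphic Literature.NumberTheory.GaloisRepresentations
open Summit.Langlands

namespace Summit.Langlands.Langlands.Theorems.IrreducibleOffSector

/-! ## The 2026 theorem for `GL(4)` as a text hypothesis

The closed region below is stated MODULO THE TEXT of Shavali's theorem (binder `h4`), in the exact
shape of the tree's Böckle–Hui fact `isIrreducible_galoisRep_gl3_totallyReal` at `n = 4` with the
Satake-level non-self-duality hypothesis added; the same text is proposed as the Literature named
fact `Literature.NumberTheory.Automorphic.isIrreducible_galoisRep_gl4_totallyReal_of_not_essSelfDual`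
(`GL4NonSelfDualIrreducible`), which discharges `h4` by `Iff.rfl` once it is in the tree.  Text:
"for `K` totally real, `π` regular algebraic cuspidal on `GL_4(𝔸_K)` with no cuspidal `GL(1)` datum
`η` such that `t_{π,v}⁻¹ = η(ϖ_v) · t_{π,v}` a.e., every `ℓ`, `ι`, every semisimple
`r : Γ_K → GL_4(ℚ̄_ℓ)` unramified with `det(X - r(Frob_v)) = arithFrobPolyOfSatake ι q_v 4 α` at every
`v ∤ ℓ` where `π` has Satake parameter `α` is irreducible" — these `r` are exactly the representations
equivalent to the `ρ_{π,λ}`, `λ = ι⁻¹|_{ℚ(π)}`, of the source (Chebotarev + Brauer–Nesbitt).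
-/

/-! ## Essential self-duality at Satake level is twist-invariant -/

section Twist

variable {n : ℕ} {K : Type} [Field K] [NumberField K] {hcpt : isCompact_glFiniteIntegralLevel n K}

/-- Multiset bookkeeping for the twist: if `β = z · α` satisfies `β⁻¹ = e · β` (as multisets) and
`z ≠ 0`, then `α⁻¹ = (e z²) · α`. [folklore] -/
theorem map_inv_eq_map_mul_of_twist {z e : ℂ} (hz : z ≠ 0) {α : Multiset ℂ}
    (h : (α.map (z * ·)).map (fun b => b⁻¹) = (α.map (z * ·)).map (fun b => e * b)) :
    α.map (fun a => a⁻¹) = α.map (fun a => (e * z ^ 2) * a) := by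
  have h' := congrArg (Multiset.map (z * ·)) h
  simp only [Multiset.map_map, Function.comp_def] at h'
  convert h' using 2 with a a
  · rw [mul_inv, ← mul_assoc, mul_inv_cancel₀ hz, one_mul]
  · ring

/-- **Satake-level essential self-duality descends through a norm twist.**  Let `π' = π ⊗ |det|^s`
(`s` real: `W_{π'} = |det|^s · W_π`, same for `W'`).  If `π'` is essentially self-dual at Satake level
witnessed by a cuspidal `GL(1)` datum `η'` (`t_{π',v}⁻¹ = η'(ϖ_v) t_{π',v}` a.e.), then so is `π`,
witnessed by `η = η' ⊗ |·|^{2s}` (`t_{π',v} = q_v^{-s} t_{π,v}`, `t_{η,v} = q_v^{-2s} t_{η',v}`;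
Borel–Jacquet 1979, 5.7).  Contrapositive form used below: `π` not essentially self-dual ⇒ `π'` not
essentially self-dual. [cite: BorelJacquetCorvallis1979, 5.7] -/
theorem not_essSelfDual_of_twist [NeZero n] (h1 : isCompact_glFiniteIntegralLevel 1 K)
    {χ : HeckeCharacter K} {s : ℝ}
    (hχ : ∀ x : ideleGroup K, ((χ x : ℂˣ) : ℂ) = (ideleNorm x : ℂ) ^ ((s : ℝ) : ℂ))
    {π π' : AutomorphicRepData (AutomorphyDatum.gl n K hcpt)}
    (hW : π'.W = π.W.map (mulChar (detTwist n χ)))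
    (hW' : π'.W' = π.W'.map (mulChar (detTwist n χ)))
    (hnsd : ∀ η : CuspidalAutomorphicRepData 1 K h1,
      ¬ ∀ᶠ v : HeightOneSpectrum (𝓞 K) in cofinite, ∀ α : Multiset ℂ, π.HasSatakeParamAt v α →
        ∃ e : ℂ, η.1.HasSatakeParamAt v {e} ∧ α.map (fun a => a⁻¹) = α.map (fun a => e * a))
    (η' : CuspidalAutomorphicRepData 1 K h1) :
    ¬ ∀ᶠ v : HeightOneSpectrum (𝓞 K) in cofinite, ∀ β : Multiset ℂ, π'.HasSatakeParamAt v β →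
        ∃ e : ℂ, η'.1.HasSatakeParamAt v {e} ∧ β.map (fun b => b⁻¹) = β.map (fun b => e * b) := by
  intro hsd
  -- the `GL(1)` twist `η = η' ⊗ |·|^{2s}`
  obtain ⟨χ₂, hχ₂⟩ := exists_heckeCharacter_ideleNorm_cpow (K := K) (((2 * s : ℝ) : ℝ) : ℂ)
  obtain ⟨η, hηW, hηW'⟩ := exists_cuspidalAutomorphicRepData_map_mulChar_detTwist hχ₂ η'
  refine hnsd η ?_
  filter_upwards [hsd] with v hv α hα
  have hq0 : (v.residueCard : ℂ) ≠ 0 := by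
    have := v.one_lt_residueCard
    exact_mod_cast (by omega : v.residueCard ≠ 0)
  set z : ℂ := (v.residueCard : ℂ) ^ (-((s : ℝ) : ℂ)) with hz
  have hzne : z ≠ 0 := Complex.cpow_ne_zero_iff.mpr (Or.inl hq0)
  -- `t_{π',v} = z · t_{π,v}`
  have hβ : π'.HasSatakeParamAt v (α.map (z * ·)) :=
    AutomorphicRepData.HasSatakeParamAt.of_map_mulChar_detTwist_of_cpow hχ hW hW' hα
  obtain ⟨e, he, hrel⟩ := hv _ hβ
  refine ⟨e * z ^ 2, ?_, map_inv_eq_map_mul_of_twist hzne hrel⟩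
  -- `t_{η,v} = q_v^{-2s} e = e z²`
  have hη := AutomorphicRepData.HasSatakeParamAt.of_map_mulChar_detTwist_of_cpow hχ₂ hηW hηW' he
  have hz2 : (v.residueCard : ℂ) ^ (-(((2 * s : ℝ) : ℝ) : ℂ)) = z ^ 2 := by
    rw [hz, ← Complex.cpow_nat_mul]
    congr 1
    push_cast
    ring
  rw [Multiset.map_singleton] at hη
  convert hη using 2
  rw [hz2, mul_comm]

end Twist

/-! ## The closed region: `n = 4`, `K` totally real, `π` regular and not essentially self-dual -/

/-- **`IrreducibleOffSector` for `n = 4` over totally real fields, regular `π` NOT essentially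
self-dual** (a child of the crux; Shavali 2026, Thm. A).  Grant lang.S27 (the text of the route input
`GaloisRepOfRegularAlgebraic`) and the text of Shavali's Theorem A (binder `h4`, = the named fact
`isIrreducible_galoisRep_gl4_totallyReal_of_not_essSelfDual`).  Let `K` be totally real, `π` cuspidal
on `GL_4(𝔸_K)`, L-algebraic with a regular infinity type, and not essentially self-dual at Satake
level (no cuspidal `GL(1)` datum `η` at level `h1` with `t_{π,v}⁻¹ = η(ϖ_v) · t_{π,v}` a.e.).  Then for
every `ℓ`, `ι` and every `ρ : Γ_K → GL_4(ℚ̄_ℓ)` Satake–Frobenius compatible with `(π, ι)` at almost all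
places, `ρ` is irreducible.  Proof: the half-twist `π' = π ⊗ |det|^{3/2}` is cuspidal, regular
algebraic (`isRegularAlgebraic_of_hasInfinityType_twist_half`) and still not essentially self-dual
(`not_essSelfDual_of_twist`); lang.S27 attaches a semisimple `r` to `(π', ι)`, irreducible by the
fact; cross the half-twist (`isIrreducible_of_twist_attached_irreducible`, Chebotarev–Brauer–Nesbitt).
[claim: Shavali2026GL4, status: under-review] [cite: HarrisLanTaylorThorneRMS2016, Thm. A]
[cite: BuzzardGeeLMS2014, §5.3] -/
theorem isIrreducible_rank_four_totallyReal_of_isRegular_of_not_essSelfDual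
    (hGR : ∀ (n : ℕ) (K : Type) [Field K] [NumberField K] (hcpt : Literature.NumberTheory.Automorphic.isCompact_glFiniteIntegralLevel n K), (NumberField.IsTotallyReal K ∨ NumberField.IsCMField K) → ∀ (π : Literature.NumberTheory.Automorphic.CuspidalAutomorphicRepData n K hcpt), π.1.IsRegularAlgebraic → ∀ (ℓ : ℕ) [Fact ℓ.Prime] (ι : PadicAlgCl ℓ ≃+* ℂ), ∃ r : Literature.NumberTheory.GaloisRepresentations.FramedGaloisRep K (PadicAlgCl ℓ) n, r.toGaloisRep.IsSemisimple ∧ ∀ (v : IsDedekindDomain.HeightOneSpectrum (NumberField.RingOfIntegers K)) (α : Multiset ℂ), π.1.HasSatakeParamAt v α → ((ℓ : ℕ) : NumberField.RingOfIntegers K) ∉ v.asIdeal → r.IsUnramifiedAt v ∧ r.HasFrobCharpolyAt v (Literature.NumberTheory.Automorphic.arithFrobPolyOfSatake ι v.residueCard n α))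
    (h4 : ∀ (K : Type) [Field K] [NumberField K], NumberField.IsTotallyReal K → ∀ (h1 : Literature.NumberTheory.Automorphic.isCompact_glFiniteIntegralLevel 1 K) (hcpt : Literature.NumberTheory.Automorphic.isCompact_glFiniteIntegralLevel 4 K) (π : Literature.NumberTheory.Automorphic.CuspidalAutomorphicRepData 4 K hcpt), π.1.IsRegularAlgebraic → (∀ η : Literature.NumberTheory.Automorphic.CuspidalAutomorphicRepData 1 K h1, ¬ ∀ᶠ v : IsDedekindDomain.HeightOneSpectrum (NumberField.RingOfIntegers K) in Filter.cofinite, ∀ α : Multiset ℂ, π.1.HasSatakeParamAt v α → ∃ e : ℂ, η.1.HasSatakeParamAt v {e} ∧ α.map (fun a => a⁻¹) = α.map (fun a => e * a)) → ∀ (ℓ : ℕ) [Fact ℓ.Prime] (ι : PadicAlgCl ℓ ≃+* ℂ) (r : Literature.NumberTheory.GaloisRepresentations.FramedGaloisRep K (PadicAlgCl ℓ) 4), r.toGaloisRep.IsSemisimple → (∀ (v : IsDedekindDomain.HeightOneSpectrum (NumberField.RingOfIntegers K)) (α : Multiset ℂ), π.1.HasSatakeParamAt v α → ((ℓ : ℕ)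 : NumberField.RingOfIntegers K) ∉ v.asIdeal → r.IsUnramifiedAt v ∧ r.HasFrobCharpolyAt v (Literature.NumberTheory.Automorphic.arithFrobPolyOfSatake ι v.residueCard 4 α)) → r.toGaloisRep.IsIrreducible)
    {K : Type} [Field K] [NumberField K] (hK : IsTotallyReal K)
    (h1 : isCompact_glFiniteIntegralLevel 1 K) {hcpt : isCompact_glFiniteIntegralLevel 4 K}
    (π : CuspidalAutomorphicRepData 4 K hcpt) (hL : π.1.IsLAlgebraic)
    (hreg : ∃ T : InfinityType K 4, π.1.HasInfinityType T ∧ T.IsRegular)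
    (hnsd : ∀ η : CuspidalAutomorphicRepData 1 K h1,
      ¬ ∀ᶠ v : HeightOneSpectrum (𝓞 K) in cofinite, ∀ α : Multiset ℂ, π.1.HasSatakeParamAt v α →
        ∃ e : ℂ, η.1.HasSatakeParamAt v {e} ∧ α.map (fun a => a⁻¹) = α.map (fun a => e * a))
    {ℓ : ℕ} [Fact ℓ.Prime] (ι : PadicAlgCl ℓ ≃+* ℂ) (ρ : FramedGaloisRep K (PadicAlgCl ℓ) 4)
    (hρ : ∀ᶠ v : HeightOneSpectrum (𝓞 K) in cofinite, SatakeFrobCompatibleAt ι π.1 ρ v) :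
    ρ.toGaloisRep.IsIrreducible := by
  haveI : NeZero (4 : ℕ) := ⟨four_ne_zero⟩
  obtain ⟨T, hT, hTL, hTR⟩ := exists_infinityType_isLAlgebraic_isRegular π.1 hL hreg
  -- the regular algebraic twist `π' = π ⊗ |det|^{3/2}`
  obtain ⟨χ, π', hχ, hW, hW', hT'⟩ := π.exists_twist_hasInfinityType ((((4 : ℕ) : ℝ) - 1) / 2) hT
  have hRA : π'.1.IsRegularAlgebraic :=
    isRegularAlgebraic_of_hasInfinityType_twist_half (by exact_mod_cast hT') hTL hTR
  -- `π'` is still not essentially self-dual at Satake level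
  have hnsd' := not_essSelfDual_of_twist h1 hχ hW hW' hnsd
  -- an attached semisimple `r` of `(π', ι)` (lang.S27), irreducible by the 2026 theorem
  obtain ⟨r, hss, hr⟩ := hGR 4 K hcpt (Or.inl hK) π' hRA ℓ ι
  have hirr : r.toGaloisRep.IsIrreducible := h4 K hK h1 hcpt π' hRA hnsd' ℓ ι r hss hr
  exact isIrreducible_of_twist_attached_irreducible (by norm_num) ι hχ hW hW' hirr hr ρ hρ

/-! ## In the binder shape of the crux -/

/-- **The rank-four totally-real non-self-dual region of `IrreducibleOffSector`** (binder shape of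
the crux at `n = 4`; the cuspidality / L-algebraicity hypotheses are used, the off-sector clause is
idle since `4 ≠ 3`): granting the lang.S27 text and Shavali's Theorem A, for `K` totally real and `π`
cuspidal on `GL_4(𝔸_K)` with a regular infinity type and not essentially self-dual at Satake level,
every `ρ` Satake–Frobenius compatible with `(π, ι)` a.e. is irreducible, for every `ℓ`, `ι`.
[claim: Shavali2026GL4, status: under-review] [cite: HarrisLanTaylorThorneRMS2016, Thm. A] -/
theorem irreducibleOffSector_rank_four_totallyReal_of_not_essSelfDual
    (hGR : ∀ (n : ℕ) (K : Type) [Field K] [NumberField K] (hcpt : Literature.NumberTheory.Automorphic.isCompact_glFiniteIntegralLevel n K), (NumberField.IsTotallyReal K ∨ NumberField.IsCMField K) → ∀ (π : Literature.NumberTheory.Automorphic.CuspidalAutomorphicRepData n K hcpt), π.1.IsRegularAlgebraic → ∀ (ℓ : ℕ) [Fact ℓ.Prime] (ι : PadicAlgCl ℓ ≃+* ℂ), ∃ r : Literature.NumberTheory.GaloisRepresentations.FramedGaloisRep K (PadicAlgCl ℓ) n, r.toGaloisRep.IsSemisimple ∧ ∀ (v : IsDedekindDomain.HeightOneSpectrum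 (NumberField.RingOfIntegers K)) (α : Multiset ℂ), π.1.HasSatakeParamAt v α → ((ℓ : ℕ) : NumberField.RingOfIntegers K) ∉ v.asIdeal → r.IsUnramifiedAt v ∧ r.HasFrobCharpolyAt v (Literature.NumberTheory.Automorphic.arithFrobPolyOfSatake ι v.residueCard n α))
    (h4 : ∀ (K : Type) [Field K] [NumberField K], NumberField.IsTotallyReal K → ∀ (h1 : Literature.NumberTheory.Automorphic.isCompact_glFiniteIntegralLevel 1 K) (hcpt : Literature.NumberTheory.Automorphic.isCompact_glFiniteIntegralLevel 4 K) (π : Literature.NumberTheory.Automorphic.CuspidalAutomorphicRepData 4 K hcpt), π.1.IsRegularAlgebraic → (∀ η : Literature.NumberTheory.Automorphic.CuspidalAutomorphicRepData 1 K h1, ¬ ∀ᶠ v : IsDedekindDomain.HeightOneSpectrum (NumberField.RingOfIntegers K) in Filter.cofinite, ∀ α : Multiset ℂ, π.1.HasSatakeParamAt v α → ∃ e : ℂ, η.1.HasSatakeParamAt v {e} ∧ α.map (fun a => a⁻¹) = α.map (fun a => e * a)) → ∀ (ℓ : ℕ) [Fact ℓ.Prime] (ι : PadicAlgCl ℓ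 ≃+* ℂ) (r : Literature.NumberTheory.GaloisRepresentations.FramedGaloisRep K (PadicAlgCl ℓ) 4), r.toGaloisRep.IsSemisimple → (∀ (v : IsDedekindDomain.HeightOneSpectrum (NumberField.RingOfIntegers K)) (α : Multiset ℂ), π.1.HasSatakeParamAt v α → ((ℓ : ℕ) : NumberField.RingOfIntegers K) ∉ v.asIdeal → r.IsUnramifiedAt v ∧ r.HasFrobCharpolyAt v (Literature.NumberTheory.Automorphic.arithFrobPolyOfSatake ι v.residueCard 4 α)) → r.toGaloisRep.IsIrreducible) :
    ∀ (K : Type) [Field K] [NumberField K] (hcpt : isCompact_glFiniteIntegralLevel 4 K),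
      0 < 4 → IsTotallyReal K → ∀ (h1 : isCompact_glFiniteIntegralLevel 1 K)
        (π : CuspidalAutomorphicRepData 4 K hcpt),
        (∃ T : InfinityType K 4, π.1.HasInfinityType T ∧ T.IsRegular) →
        (∀ η : CuspidalAutomorphicRepData 1 K h1,
          ¬ ∀ᶠ v : HeightOneSpectrum (𝓞 K) in cofinite, ∀ α : Multiset ℂ, π.1.HasSatakeParamAt v α →
            ∃ e : ℂ, η.1.HasSatakeParamAt v {e} ∧ α.map (fun a => a⁻¹) = α.map (fun a => e * a)) →
        π.1.IsLAlgebraic →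
        ¬ (4 = 3 ∧ NumberField.IsCMField K ∧
            ∃ T : InfinityType K 4, π.1.HasInfinityType T ∧ T.IsRegular) →
        ∀ (ℓ : ℕ) [Fact ℓ.Prime] (ι : PadicAlgCl ℓ ≃+* ℂ) (ρ : FramedGaloisRep K (PadicAlgCl ℓ) 4),
          (∀ᶠ v : HeightOneSpectrum (𝓞 K) in cofinite, SatakeFrobCompatibleAt ι π.1 ρ v) →
            ρ.toGaloisRep.IsIrreducible := by
  intro K _ _ hcpt _ hK h1 π hreg hnsd hL _ ℓ _ ι ρ hρ
  exact isIrreducible_rank_four_totallyReal_of_isRegular_of_not_essSelfDual hGR h4 hK h1 π hL hreg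
    hnsd ι ρ hρ

end Summit.Langlands.Langlands.Theorems.IrreducibleOffSector

end
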